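import Summits.Langlands.Langlands.Theorems.IrreducibilityBySelfDualityReciprocityUpToIrreducibilityRStringDefs
import HarnessLib

/-!
# Strings with isomorphic heads and equal lengths are isomorphic Weil–Deligne representations

Helper file for stub S-17a-B `stub_isEquivalent_of_finrank_invariants_tprod_eq` of line `Sketch`
(crux stmt-Langlands-17925 `IrreducibilityBySelfDuality.ReciprocityUpToIrreducibilityR`), registered
sub-goal G4 `stub_isEquivalent_ofSubrep_stringSpan`: if `H ≤ V` and `H' ≤ V'` are heads of strings of
the same length `e` in `σ = (ρ, N)` and `σ' = (ρ', N')` (vocabulary `IsStringHead`, `stringSpan` of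
`…RStringDefs`) and the head representations `ρ|_H ≅ ρ'|_{H'}` are isomorphic as representations of
`W_F`, then the sub-Weil–Deligne representations on the strings
`string(H, e) = H ⊕ N H ⊕ ⋯ ⊕ N^{e-1} H` and `string(H', e)` are isomorphic (Tate, Corvallis 1979,
(4.1.5): both are `ρ|_H ⊗ Sp(e)`).

Proof: the string map `Ψ : H^e → string(H, e)`, `(y_j) ↦ Σ_j N^j y_j`, is a linear isomorphism
(surjective by definition, injective by the independence of the pieces — `strMap_eq_zero_imp` of
`…RStringBasics`, re-proved privately here so that this file only depends on `…RStringDefs`); it transports `ρ(w)` to the slot-wise twisted action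
`(y_j) ↦ (q^{j deg w} ρ(w) y_j)` (`ρ_strMap`) and `N` to the shift (`N_strMap_succ`).  Hence
`Φ := Ψ' ∘ E^e ∘ Ψ⁻¹` intertwines both `ρ` and `N` for any `W_F`-equivariant iso `E : H ≅ H'`.
Pure linear algebra, no definitions; standard axioms only.
-/

noncomputable section

set_option linter.dupNamespace false

open Module
open Literature.NumberTheory.Automorphic Literature.NumberTheory.GaloisRepresentations
open Literature.NumberTheory.GaloisRepresentations.WeilGroup
open Literature.NumberTheory.GaloisRepresentations.IsNonarchimedeanLocalField

namespace Summit.Langlands.Langlands.Theorems.ReciprocityUpToIrreducibilityR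

variable {F : Type} [Field F] [ValuativeRel F] [TopologicalSpace F] [IsNonarchimedeanLocalField F]
variable {V : Type*} [AddCommGroup V] [Module ℂ V]

/-! ## Independence of the pieces of a string (private copy of `…RStringBasics`) -/

section Independence

variable (r : WeilDeligneRep F ℂ V)

/-- Powers of `N` pass through the string map: `N^k Σ N^j z_j = Σ N^j (N^k z_j)`. [folklore] -/
private theorem pow_N_strMap_aux (k d : ℕ) (z : Fin d → V) :
    (r.N ^ k) (strMap r d z) = strMap r d (fun j => (r.N ^ k) (z j)) := by
  simp only [strMap_apply, map_sum]
  refine Finset.sum_congr rfl fun j _ => ?_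
  rw [← Module.End.mul_apply, ← pow_add, add_comm, pow_add, Module.End.mul_apply]

variable {r}

/-- If `P` meets `ker N^d` trivially, then `N P` meets `ker N^{d-1}` trivially. [folklore] -/
private theorem disjoint_map_N_ker_aux {P : Submodule ℂ V} {d : ℕ}
    (hdisj : Disjoint P (LinearMap.ker (r.N ^ d))) :
    Disjoint (P.map r.N) (LinearMap.ker (r.N ^ (d - 1))) := by
  cases d with
  | zero =>
    rw [Nat.zero_sub, pow_zero, Module.End.one_eq_id, LinearMap.ker_id]
    exact disjoint_bot_right
  | succ d =>
    rw [Nat.add_sub_cancel, Submodule.disjoint_def]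
    rintro _ ⟨p, hp, rfl⟩ hx
    rw [LinearMap.mem_ker, ← Module.End.mul_apply, ← pow_succ] at hx
    have hp0 : p = 0 := (Submodule.disjoint_def.mp hdisj) p hp (LinearMap.mem_ker.mpr hx)
    rw [hp0, map_zero]

/-- `N P ≤ ker N^d` when `P ≤ ker N^{d+1}`. [folklore] -/
private theorem map_N_le_ker_aux {P : Submodule ℂ V} {d : ℕ}
    (hP : P ≤ LinearMap.ker (r.N ^ (d + 1))) : P.map r.N ≤ LinearMap.ker (r.N ^ d) := by
  rintro _ ⟨p, hp, rfl⟩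
  have := hP hp
  rw [LinearMap.mem_ker] at this ⊢
  rwa [← Module.End.mul_apply, ← pow_succ]

variable (r) in
/-- **Independence of the pieces of a string** (the statement of `strMap_eq_zero_imp` of
`…RStringBasics`): if `P ≤ ker N^d` and `N^{d-1}` is injective on `P`, then `Σ_{j<d} N^j y_j = 0`
with all `y_j ∈ P` forces `y = 0`. [cite: TateCorvallis1979, (4.1.5)] -/
private theorem strMap_eq_zero_imp_aux : ∀ (d : ℕ) (P : Submodule ℂ V),
    P ≤ LinearMap.ker (r.N ^ d) → Disjoint P (LinearMap.ker (r.N ^ (d - 1))) →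
    ∀ y : Fin d → V, (∀ j, y j ∈ P) → strMap r d y = 0 → y = 0 := by
  intro d
  induction d with
  | zero => intro P _ _ y _ _; funext j; exact Fin.elim0 j
  | succ d ih =>
    intro P hP hdisj y hy hsum
    rw [Nat.add_sub_cancel] at hdisj
    set z : Fin d → V := fun j => r.N (y j.succ) with hz
    have hzP : ∀ j, z j ∈ P.map r.N := fun j => Submodule.mem_map_of_mem (hy j.succ)
    have h0 : y 0 = 0 := by
      have h1 : (r.N ^ d) (strMap r (d + 1) y) = (r.N ^ d) (y 0) := by
        rw [strMap_succ, map_add, pow_N_strMap_aux]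
        have h2 : (fun j : Fin d => (r.N ^ d) (r.N (y j.succ))) = 0 := by
          funext j
          have := hP (hy j.succ)
          rw [LinearMap.mem_ker, pow_succ, Module.End.mul_apply] at this
          simpa using this
        rw [h2, map_zero, add_zero]
      rw [hsum, map_zero] at h1
      exact (Submodule.disjoint_def.mp hdisj) _ (hy 0) (LinearMap.mem_ker.mpr h1.symm)
    have hz0 : z = 0 := by
      refine ih (P.map r.N) (map_N_le_ker_aux hP) (disjoint_map_N_ker_aux hdisj) z hzP ?_
      have h1 : strMap r (d + 1) y = y 0 + strMap r d z := strMap_succ r d y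
      rw [hsum, h0, zero_add] at h1
      exact h1.symm
    funext j
    refine Fin.cases h0 (fun i => ?_) j
    have hNy : r.N (y i.succ) = 0 := congr_fun hz0 i
    have hker : y i.succ ∈ LinearMap.ker (r.N ^ d) := by
      cases d with
      | zero => exact Fin.elim0 i
      | succ d =>
        rw [LinearMap.mem_ker, pow_succ, Module.End.mul_apply, hNy, map_zero]
    exact (Submodule.disjoint_def.mp hdisj) _ (hy i.succ) hker

end Independence

/-! ## The string map on the head is a linear isomorphism `H^d ≅ string(H, d)` -/

section StrMapHead

variable (r : WeilDeligneRep F ℂ V) (H : Submodule ℂ V) (d : ℕ)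

/-- **`H^d ≅ string(H, d)` by `(y_j) ↦ Σ_j N^j y_j`** for a head `H` with `N^d H = 0` and `N^{d-1}`
injective on `H`: the string map with values in the string is surjective by definition of the string
and injective by the independence of the pieces of a string. [cite: TateCorvallis1979, (4.1.5)] -/
theorem exists_strEquivHead (hle : H ≤ LinearMap.ker (r.N ^ d))
    (hdisj : Disjoint H (LinearMap.ker (r.N ^ (d - 1)))) :
    ∃ Ψ : (Fin d → H) ≃ₗ[ℂ] stringSpan r H d, ∀ y, (Ψ y : V) = strMap r d (fun j => (y j : V)) := by
  let ψ : (Fin d → H) →ₗ[ℂ] stringSpan r H d :=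
    LinearMap.codRestrict (stringSpan r H d) (strMap r d ∘ₗ H.subtype.compLeft (Fin d))
      fun y => strMap_mem_stringSpan r fun j => (y j).2
  have hψ : ∀ y, (ψ y : V) = strMap r d (fun j => (y j : V)) := fun _ => rfl
  have hinj : Function.Injective ψ := by
    rw [← LinearMap.ker_eq_bot, LinearMap.ker_eq_bot']
    intro y hy
    have h0 : (fun j => (y j : V)) = 0 :=
      strMap_eq_zero_imp_aux r d H hle hdisj _ (fun j => (y j).2) (congrArg Subtype.val hy)
    funext j
    exact Subtype.ext (congr_fun h0 j)
  have hsurj : Function.Surjective ψ := by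
    rintro ⟨x, hx⟩
    obtain ⟨y, hy, rfl⟩ := (mem_stringSpan_iff r).mp hx
    exact ⟨fun j => ⟨y j, hy j⟩, Subtype.ext rfl⟩
  exact ⟨LinearEquiv.ofBijective ψ ⟨hinj, hsurj⟩, hψ⟩

/-- **`ρ(w)` on the string is the slot-wise twisted action on `H^d`**: through any `Ψ` lifting the
string map, `ρ(w) Σ_j N^j y_j = Σ_j N^j (q^{j deg w} ρ(w) y_j)`.
[cite: TateCorvallis1979, (4.1.2), (4.1.5)] -/
theorem ρ_ofSubrep_stringSpan_apply (hS : r.IsSubrep (stringSpan r H d)) (hW : IsWStable r H)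
    {Ψ : (Fin d → H) → stringSpan r H d} (hΨ : ∀ y, (Ψ y : V) = strMap r d (fun j => (y j : V)))
    (w : WeilGroup F) (y : Fin d → H) :
    (r.ofSubrep (stringSpan r H d) hS).ρ w (Ψ y) =
      Ψ (stringModelAct (r.ρ.subrepresentation H hW) d w y) := by
  refine Subtype.ext ?_
  rw [hΨ]
  change r.ρ w (Ψ y : V) = _
  rw [hΨ, ρ_strMap]
  rfl

/-- **`N` on the string is the shift on `H^d`**: through any `Ψ` lifting the string map,
`N Σ_j N^j y_j = Σ_j N^j y_{j-1}` (using `N^d y_{d-1} = 0`). [cite: TateCorvallis1979, (4.1.5)] -/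
theorem N_ofSubrep_stringSpan_apply (hS : r.IsSubrep (stringSpan r H d))
    (hle : H ≤ LinearMap.ker (r.N ^ d))
    {Ψ : (Fin d → H) → stringSpan r H d} (hΨ : ∀ y, (Ψ y : V) = strMap r d (fun j => (y j : V)))
    (y : Fin d → H) :
    (r.ofSubrep (stringSpan r H d) hS).N (Ψ y) = Ψ (shiftMap H d y) := by
  refine Subtype.ext ?_
  rw [hΨ]
  change r.N (Ψ y : V) = _
  rw [hΨ]
  cases d with
  | zero => simp [strMap_apply]
  | succ d =>
    rw [N_strMap_succ r d _ (LinearMap.mem_ker.mp (hle (y (Fin.last d)).2))]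
    congr 1
    funext j
    refine Fin.cases ?_ (fun i => ?_) j
    · simp [shiftMap_apply]
    · have hi : shiftMap H (d + 1) y i.succ = y i.castSucc := by
        rw [shiftMap_apply, dif_neg (by simp)]
        exact congrArg y (Fin.ext (by simp))
      rw [Fin.cons_succ, hi]

end StrMapHead

/-! ## Strings with isomorphic heads -/

/-- **Strings of equal length over `W_F`-isomorphic heads are isomorphic Weil–Deligne
representations**: given a `W_F`-equivariant linear isomorphism `E : H ≅ H'` of the heads, the map
`Σ_j N^j y_j ↦ Σ_j N'^j E(y_j)` is an isomorphism `string(H, e) ≅ string(H', e)` of Weil–Deligne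
representations. [cite: TateCorvallis1979, (4.1.5)] -/
theorem isEquivalent_ofSubrep_stringSpan_of_linearEquiv {V' : Type*} [AddCommGroup V']
    [Module ℂ V'] {σ : WeilDeligneRep F ℂ V} {σ' : WeilDeligneRep F ℂ V'} {H : Submodule ℂ V}
    {H' : Submodule ℂ V'} {e : ℕ} (h : IsStringHead σ H e) (h' : IsStringHead σ' H' e)
    (E : H ≃ₗ[ℂ] H')
    (hE : ∀ (w : WeilGroup F) (v : H), E (σ.ρ.subrepresentation H h.irreducible.2.1 w v) =
      σ'.ρ.subrepresentation H' h'.irreducible.2.1 w (E v)) :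
    (σ.ofSubrep (stringSpan σ H e) (isSubrep_stringSpan h.irreducible.2.1 h.le_ker)).IsEquivalent
      (σ'.ofSubrep (stringSpan σ' H' e) (isSubrep_stringSpan h'.irreducible.2.1 h'.le_ker)) := by
  obtain ⟨Ψ, hΨ⟩ := exists_strEquivHead σ H e h.le_ker h.disjoint_ker
  obtain ⟨Ψ', hΨ'⟩ := exists_strEquivHead σ' H' e h'.le_ker h'.disjoint_ker
  set Φ : stringSpan σ H e ≃ₗ[ℂ] stringSpan σ' H' e :=
    Ψ.symm ≪≫ₗ LinearEquiv.piCongrRight (fun _ : Fin e => E) ≪≫ₗ Ψ'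
  have hΦ : ∀ y : Fin e → H, Φ (Ψ y) = Ψ' (fun j => E (y j)) := by
    intro y
    change Ψ' (LinearEquiv.piCongrRight (fun _ : Fin e => E) (Ψ.symm (Ψ y))) = _
    rw [LinearEquiv.symm_apply_apply]
    rfl
  refine ⟨{ toRepEquiv := Representation.Equiv.mk Φ fun w => ?_, comm_N := ?_ }⟩
  · refine LinearMap.ext fun x => ?_
    obtain ⟨y, rfl⟩ := Ψ.surjective x
    rw [LinearMap.comp_apply, LinearMap.comp_apply, LinearEquiv.coe_coe,
      ρ_ofSubrep_stringSpan_apply σ H e _ h.irreducible.2.1 hΨ, hΦ, hΦ,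
      ρ_ofSubrep_stringSpan_apply σ' H' e _ h'.irreducible.2.1 hΨ']
    congr 1
    funext j
    rw [stringModelAct_apply, stringModelAct_apply, map_smul, hE]
  · change (Φ : stringSpan σ H e →ₗ[ℂ] stringSpan σ' H' e) ∘ₗ (σ.ofSubrep (stringSpan σ H e) _).N =
      (σ'.ofSubrep (stringSpan σ' H' e) _).N ∘ₗ (Φ : stringSpan σ H e →ₗ[ℂ] stringSpan σ' H' e)
    refine LinearMap.ext fun x => ?_
    obtain ⟨y, rfl⟩ := Ψ.surjective x
    rw [LinearMap.comp_apply, LinearMap.comp_apply, LinearEquiv.coe_coe,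
      N_ofSubrep_stringSpan_apply σ H e _ h.le_ker hΨ, hΦ, hΦ,
      N_ofSubrep_stringSpan_apply σ' H' e _ h'.le_ker hΨ']
    congr 1
    funext j
    rw [shiftMap_apply, shiftMap_apply]
    split_ifs with hj
    · exact map_zero E
    · rfl

/-- **Strings of equal length over isomorphic heads are isomorphic** (heads isomorphic as
representations of `W_F`, Mathlib `Representation.Equiv` of the subrepresentations).
[cite: TateCorvallis1979, (4.1.5)] -/
theorem isEquivalent_ofSubrep_stringSpan {V' : Type*} [AddCommGroup V'] [Module ℂ V']
    {σ : WeilDeligneRep F ℂ V} {σ' : WeilDeligneRep F ℂ V'} {H : Submodule ℂ V} {H' : Submodule ℂ V'}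
    {e : ℕ} (h : IsStringHead σ H e) (h' : IsStringHead σ' H' e)
    (eH : (σ.ρ.subrepresentation H h.irreducible.2.1).Equiv
      (σ'.ρ.subrepresentation H' h'.irreducible.2.1)) :
    (σ.ofSubrep (stringSpan σ H e) (isSubrep_stringSpan h.irreducible.2.1 h.le_ker)).IsEquivalent
      (σ'.ofSubrep (stringSpan σ' H' e) (isSubrep_stringSpan h'.irreducible.2.1 h'.le_ker)) :=
  isEquivalent_ofSubrep_stringSpan_of_linearEquiv h h' eH.toLinearEquiv fun w v =>
    Representation.IntertwiningMap.isIntertwining _ _ eH.toIntertwiningMap w v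

/-- **Registered sub-goal G4 `stub_isEquivalent_ofSubrep_stringSpan`** (toward stub S-17a-B): strings
of the same length `e` over heads `H ≤ V`, `H' ≤ V'` that are isomorphic as representations of `W_F`
are isomorphic sub-Weil–Deligne representations — the isomorphism is
`Σ_j N^j y_j ↦ Σ_j N'^j e_H(y_j)`, well defined and bijective by the independence of the pieces of a
string, `W_F`-equivariant by `ρ(w) N^j = q^{j deg w} N^j ρ(w)` on both sides, and `N`-compatible
because `N` is the shift on both sides. [cite: TateCorvallis1979, (4.1.5)] -/
theorem stub_isEquivalent_ofSubrep_stringSpan : ∀ (F : Type) [Field F] [ValuativeRel F] [TopologicalSpace F] [IsNonarchimedeanLocalField F] (V : Type) [AddCommGroup V] [Module ℂ V] [FiniteDimensional ℂ V] (V' : Type) [AddCommGroup V'] [Module ℂ V'] [FiniteDimensional ℂ V'] (σ : WeilDeligneRep F ℂ V) (σ' : WeilDeligneRep F ℂ V') (H : Submodule ℂ V) (H' : Submodule ℂ V') (e : ℕ) (h : IsStringHead σ H e) (h' : IsStringHead σ' H' e), Nonempty ((σ.ρ.subrepresentation H h.irreducible.2.1).Equiv (σ'.ρ.subrepresentation H'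 h'.irreducible.2.1)) → (σ.ofSubrep (stringSpan σ H e) (isSubrep_stringSpan h.irreducible.2.1 h.le_ker)).IsEquivalent (σ'.ofSubrep (stringSpan σ' H' e) (isSubrep_stringSpan h'.irreducible.2.1 h'.le_ker)) :=
  fun _ _ _ _ _ _ _ _ _ _ _ _ _ _ _ _ _ _ h h' ⟨eH⟩ => isEquivalent_ofSubrep_stringSpan h h' eH

end Summit.Langlands.Langlands.Theorems.ReciprocityUpToIrreducibilityR

end
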